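import Mathlib
import Summits.MatrixMultiplication.MatrixMultiplication.Theorems.GradedDesignFamily.Negative.SubfieldCellTao
import Summits.MatrixMultiplication.MatrixMultiplication.Theorems.GradedDesignFamily.Negative.SubfieldCellPopularSet

/-!
# `¬S3` from (BGT) ∧ (Dickson) alone; Tao's product-set theorem kernel-checked
# (crux `LevelGradedCohnUmans.GradedDesignFamily`, stmt-MatrixMultiplication-7610; negative side,
# line `quadratic-extension-level-one-cell`, unit b2b-lgcu-subfield gen 18)

HONEST FRAMING.  Two one-line compositions: `taoProductSet` = Tao's product-set theorem
[Tao2006, Thm 4.6] (hypothesis (T) of `not_subfieldCell_of_literature`), obtained from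
`taoProductSet_of_popularSet` (`SubfieldCellTao.lean`) and the now-proved popular-set proposition
`popularSet_prop` (`SubfieldCellPopularSet.lean`); and `not_subfieldCell_of_BGT_Dickson` : the
design stub `stub_subfieldCell` (S3) is FALSE modulo exactly two published inputs —
Breuillard–Green–Tao for `SL₂` (BGT, [BreuillardGreenTao2011, Thm 1.3]) and Dickson's
classification (large proper subgroups of `SL₂(𝔽_q)` fix a line).  A NEGATIVE decision of the stub;
NOT summit progress.

Sorry-free. [folklore]
-/

set_option linter.dupNamespace false

open scoped Pointwise

namespace Summit.MatrixMultiplication.MatrixMultiplication.Theorems.GradedDesignFamily.Negative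

/-- **(T) kernel-checked**: Tao's product-set theorem [Tao2006, Thm 4.6] from Mathlib alone. -/
theorem taoProductSet :
    ∃ M : ℝ → ℝ, ∀ K₀ : ℝ, 1 ≤ K₀ → 1 ≤ M K₀ ∧
      ∀ (G : Type) [Group G] [DecidableEq G] (A B : Finset G), A.Nonempty → B.Nonempty →
        ((A * B).card : ℝ) ≤ K₀ * Real.sqrt ((A.card : ℝ) * B.card) →
        ∃ H X : Finset G, IsApproximateSubgroup (M K₀) (H : Set G) ∧ (X.card : ℝ) ≤ M K₀ ∧
          (H.card : ℝ) ≤ M K₀ * Real.sqrt ((A.card : ℝ) * B.card) ∧ A ⊆ X * H ∧ B ⊆ H * X :=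
  taoProductSet_of_popularSet popularSet_prop

/-- **`¬S3` from (BGT) ∧ (Dickson) alone** — the design stub `stub_subfieldCell` is false modulo
Breuillard–Green–Tao for `SL₂` and Dickson's classification; Tao's theorem is now proved in-tree.
NOT summit progress. [folklore] -/
theorem not_subfieldCell_of_BGT_Dickson
    (hBGT : ∃ C : ℝ → ℝ, ∀ K₀ : ℝ, 1 ≤ C K₀ ∧
      ∀ (K : Type) [Field K] [Fintype K] [DecidableEq K]
        (B : Finset (Matrix.GeneralLinearGroup (Fin 2) K)),
        (∀ b ∈ B, Matrix.GeneralLinearGroup.det b = 1) →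
        IsApproximateSubgroup K₀ (B : Set (Matrix.GeneralLinearGroup (Fin 2) K)) →
        Subgroup.closure (B : Set (Matrix.GeneralLinearGroup (Fin 2) K)) =
          (Matrix.GeneralLinearGroup.det : Matrix.GeneralLinearGroup (Fin 2) K →* Kˣ).ker →
        (B.card : ℝ) ≤ C K₀ ∨
          (Nat.card (Matrix.GeneralLinearGroup.det :
              Matrix.GeneralLinearGroup (Fin 2) K →* Kˣ).ker : ℝ) ≤ C K₀ * B.card)
    (hDickson : ∀ β : ℝ, 0 < β → ∃ Q₅ : ℕ, ∀ (K : Type) [Field K] [Fintype K] [DecidableEq K],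
      Q₅ ≤ Fintype.card K → ∀ L : Subgroup (Matrix.GeneralLinearGroup (Fin 2) K),
        L ≤ (Matrix.GeneralLinearGroup.det : Matrix.GeneralLinearGroup (Fin 2) K →* Kˣ).ker →
        L ≠ (Matrix.GeneralLinearGroup.det : Matrix.GeneralLinearGroup (Fin 2) K →* Kˣ).ker →
        (∃ B : Finset (Matrix.GeneralLinearGroup (Fin 2) K),
          (↑B : Set (Matrix.GeneralLinearGroup (Fin 2) K)) ⊆ L ∧
            β * (Fintype.card K : ℝ) ^ 2 ≤ B.card) →
        ∃ v : Fin 2 → K, v ≠ 0 ∧ ∀ g ∈ L, ∃ t : K,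
          (g : Matrix (Fin 2) (Fin 2) K).mulVec v = t • v) :
    ¬ (∃ c : ℝ, 0 < c ∧ ∀ N : ℕ, ∃ (k K : Type) (_ : Field k) (_ : Fintype k) (_ : DecidableEq k)
      (_ : Field K) (_ : Fintype K) (_ : DecidableEq K)
      (φ : Matrix.SpecialLinearGroup (Fin 2) k →* Matrix.GeneralLinearGroup (Fin 2) K),
      Function.Injective φ ∧ Fintype.card K = Fintype.card k ^ 2 ∧ N ≤ Fintype.card K ∧
      ∃ Y Z : Finset (Matrix.GeneralLinearGroup (Fin 2) K),
        c * (Fintype.card K : ℝ) ^ (3 / 2 : ℝ) ≤ (Finset.univ.image φ).card ∧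
        c * (Fintype.card K : ℝ) ^ (3 / 2 : ℝ) ≤ Y.card ∧
        c * (Fintype.card K : ℝ) ^ (3 / 2 : ℝ) ≤ Z.card ∧
        ∀ z₀ ∈ Z, ∃ cf : (Fin 2 → K) → (Fin 2 → K) → ℂ,
          ∀ a : Matrix.SpecialLinearGroup (Fin 2) k, ∀ y ∈ Y, ∀ y' ∈ Y, ∀ z ∈ Z,
            (∑ u : Fin 2 → K, cf u (((φ a * y * y'⁻¹ * z : Matrix.GeneralLinearGroup (Fin 2) K) :
                Matrix (Fin 2) (Fin 2) K).mulVec u)) =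
              if a = 1 ∧ y = y' ∧ z = z₀ then 1 else 0) :=
  not_subfieldCell_of_popularSet popularSet_prop hBGT hDickson

end Summit.MatrixMultiplication.MatrixMultiplication.Theorems.GradedDesignFamily.Negative
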